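import Mathlib
import HarnessLib
import HarnessLib.Audit
import Summits.AnomalousDissipation.Statement
import HarnessLib.Audit.Status.Attr

/-!
Route: DebrisQuanta

DORMANT since 2026-08-24T11:33:49Z (reconciler: no traction for 6.7 d (last activity item-evidence-added at 2026-08-17T17:06:52Z); parked, not closed — `ledger route dormant route-AnomalousDissipation-DebrisQuanta --off` to reactivate) — unstaffed, not closed; items shared with open routes are served there. `ledger route dormant <id> --off` reactivates.

Route DebrisQuanta — realises idea card onsager-quanta-collapse-exponent-map ("Onsager quanta of
singular events"). THESIS: the zeroth law is carried by DECAY QUANTA OF POINT-COLLAPSE DEBRIS. By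
the card's exponent map (2/3 | 1 | 3/2: Onsager class of the debris | Kelvin/Leray scaling,
viscosity outrun | Sedov–Taylor atom), an Euler blow-up event of exponent alpha < 3/2 burns nothing
at the singular instant (no atom; item InstantBurnNeedsConcentration makes this rigorous:
L2-convergent data never burn on short windows); its only service is to MANUFACTURE, in finite time,
an Onsager-supercritical rough datum — for 2/3 < alpha < 1 the viscously arrested collapse hands
Navier–Stokes the truncated homogeneous field D_{alpha,W} = curl[ chi(|y|) |y|^(1-alpha) W(y/|y|) ]
(automatically divergence-free, |D| ~ |y|^(-alpha), singular at one point) resolved down to the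
arrest scale lambda = nu^(1/(1-alpha)) — and the quantum is then a DECAY quantum of that datum over
an O(1) window. It suffices to show X = C1 ∧ C2:
(C1, RecurrentDebris, rank 2, the unproved blow-up-class leg, made the FIRST crux explicitly) there
are a smooth steady divergence-free mean-zero force f, an exponent 2/3 < alpha < 1, an admissible
smooth profile potential W (curl(|y|^(1-alpha)W(y/|y|)) not identically 0), constants M c L E and
global Leray–Hopf solutions u_j at nu_j -> 0 with sup_t kinetic energy <= E such that every window
[T, T+L] contains a time t, from which the energy inequality holds, with u_j(t) = b + D_{alpha,W}(.
- a) + w, b smooth divergence-free with |b|,|grad b| <= M, |w|_{L2} <= c lambda_j^((3-2 alpha)/2)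
(exactly the energy D_{alpha,W} carries below lambda_j);
(C2, RobustDecayQuantumR, rank 3, the card's crux D in assembly-ready universal form; REPAIRED
2026-08-15 — it supersedes RobustDecayQuantum, stmt-2859, refuted AS TYPED by
Theorems.DebrisQuantaRobustDecayQuantum_refuted through the unpinned t = 0 slice of
Torus.IsLerayHopfOn: with t_j = 0 allowed, a constant drift carrying the debris profile only at the
junk slice met every hypothesis and burnt 0) for all such alpha, W, smooth divergence-free mean-zero
f, M, c there is q > 0 such that along every vanishing-viscosity sequence of global Leray–Hopf
solutions forced by f, every such debris state met at a POSITIVE time t (from which the energy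
inequality holds; slices at t > 0 are pinned a.e. by weak L2-continuity, Hopf1951/Galdi2000 Lemma
2.2) is followed by a burn nu_j ∫_t^{t+1} |grad u_j|^2 >= q, eventually in j;
(C3, DecayQuantumWeak, rank 4, the bare milestone) for the explicit potential W0(y) = (0, y0, 1) (a
swirl about e2 plus a differential rotation about e1: genuinely 3-D, non-axisymmetric, not a steady
Euler state), alpha = 5/6, no force: SOME vanishing-viscosity Leray–Hopf family from the fixed datum
D_{5/6,W0} dissipates liminf_j nu_j ∫_0^1 |grad u_j|^2 > 0 (the point-debris twin of
kh-fixed-ripple's FixedDatumAnomaly; its refutation = the "laminar puff" theorem closes the route).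
Lean: RecurrentDebris ∧ RobustDecayQuantumR   (X over this route's decls, namespace
Summit.AnomalousDissipation.AnomalousDissipation.Theses.DebrisQuanta; the item Assembly is the
curried X → AnomalousDissipation)
ASSEMBLY (Lean, elaborates; restated 2026-08-15, stmt-10548): RobustDecayQuantumR → RecurrentDebris
→ AnomalousDissipation — take f, nu, u0, u from C1; C2 with (alpha,W,f,M,c) gives q and, by
contradiction along reindexed subsequences, an index J beyond which every debris visit at a positive
time burns q on the next unit window; the visits in the windows [k(L+1)+1, k(L+1)+1+L] (positive
left ends, k in N) give pairwise disjoint unit burn windows inside [0, n(L+1)+1], so the Cesaro mean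
of nu_j |grad u_j|^2 over [0, n(L+1)+1] is >= nq/(n(L+1)+1) >= q/(L+2) for all n >= 1, hence
meanDissipation >= q/(L+2) (limsup >= frequently; Cesaro means bounded by sup-energy + steady
force); meanEnergy <= 2E; drop the first J indices. DECIDING THEOREM (glue, certified native):
closes : RecurrentDebris → DecayQuantumWeak → InstantBurnNeedsConcentration → DebrisDatumRegular →
RobustDecayQuantumR → Assembly → AnomalousDissipation, by modus ponens.
X as Lean Props over existing declarations only
(Literature.Analysis.FluidPDE.Torus.IsGlobalLerayHopf / IsLerayHopfOn,
Literature.Analysis.FunctionSpaces.Torus.{eGradNormSq, kineticEnergy, IsSmooth, IsDivFree,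
HasZeroMean, IsWeaklyDivFree, repr, lift}, Literature.Analysis.FluidPDE.curl, Real.smoothTransition,
EuclideanSpace !₂[..]): items RecurrentDebris, RobustDecayQuantumR, DecayQuantumWeak,
InstantBurnNeedsConcentration, DebrisDatumRegular, Assembly — all elaborate together (planner
Sketch.lean, lean check rc 0, 2026-08-15; repair sketch rc 0, 2026-08-15T16Z). RobustDecayQuantum
(stmt-2859) is no longer wanted: it stays in the negatives index as the settled negative edge 'the t
= 0 slice of a Leray–Hopf solution is junk'.

Rationale: WHY THIS LINE. Event architectures (sparks-recurrent-calm-forces-euler-blowup: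
charge/blow-up/burn/return; avalanche cards) posit that a singularity "burns a quantum". The card's
bookkeeping on Bronzi–Shvydkoy's energy measure (BronziShvydkoy2015 Thm 1.1, Rem 1.2/1.5: E_T(B_rho)
~ rho^(3-2 alpha), atom only at alpha = N/2) with the three classical exponents 2/3 (Onsager;
Shvydkoy 2009 doi:10.1016/j.jmaa.2008.09.007), 1 (Kelvin/Leray; NecasRuzickaSverak1996, Tsai1998,
JiaSverak2014) and 3/2 (Sedov–Taylor; doi:10.1016/j.crme.2019.03.002) shows the burn is never AT the
event unless atomic: it is a DECAY QUANTUM of the rough debris under Navier–Stokes on an O(1) window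
— the finite-window problem from one FIXED rough datum that no catalogued barrier touches (they need
a Lipschitz Euler solution from the datum, or shear data). Import: blow-up analysis of Euler (energy
measure, locally self-similar collapse, homogeneous profiles Shvydkoy2017) x vanishing-viscosity
bookkeeping; physical dictionary: debris at arrest scale lambda = nu^(1/(1-alpha)) <-> "turbulent
puff" in the card's nu-free inner variables (x = lambda y, t = lambda^(1+alpha) s: unit-viscosity NS
on R^3 from curl(|y|^(1-alpha)W), q > 0 iff liminf_s s^((3 alpha-2)/(1+alpha)) |grad w(s)|_2^2 > 0,
i.e. the U^3/L law of an expanding flow whose Reynolds number grows like s^((1-alpha)/(1+alpha))).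
RANKED CRUXES. #2 RecurrentDebris — the load-bearing UNPROVED leg (finite-time point collapse with
2/3<alpha<1 of smooth-forced flow, reached recurrently, uniformly in nu: Euler-blow-up class; no
provers expected, refuters welcome; made first per D-0019 plancard rule). #3 RobustDecayQuantumR —
the card's crux D, universal over admissible profiles/backgrounds/LH solutions met at POSITIVE times
(what the glue needs); repaired form of RobustDecayQuantum (stmt-2859, refuted as typed 2026-08-15
by Theorems.DebrisQuantaRobustDecayQuantum_refuted: Torus.IsLerayHopfOn never pins the slice u 0, so
with t_j = 0 a constant drift could carry the debris profile at the junk slice and burn 0; fix = 0 <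
t_j — slices at t > 0 are pinned by weak continuity — plus f divergence-free and mean-zero as
RecurrentDebris supplies; at t_j > 0 the old witness fails the debris condition eventually, since a
constant minus D_{alpha,W} stays a fixed L2-distance from every M-Lipschitz background while the
tolerance -> 0). #4 DecayQuantumWeak — one explicit datum, no force, EXISTS an anomalous LH family:
the honest milestone (kh-fixed-ripple K2 twin for point debris), decidable in principle by analysis
of one parameter-free inner problem.
SUPPORT (provable now). InstantBurnNeedsConcentration: LH solutions with L2-convergent data and
bounded steady forces burn <= eps on [0,tau(eps)] uniformly (low-mode ODE bounds + energy
inequality) — the rigorous core of the card's Q1 "no instant burn below the atom", with no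
self-similar ansatz: an instantaneous quantum FORCES loss of L2-compactness (concentration).
DebrisDatumRegular: D_{alpha,W} in L2, weakly divergence-free (so hopf_existence_torus_holds
supplies LH families), W0 admissible. Assembly (restated, stmt-10548): window bookkeeping over
windows with positive left ends [k(L+1)+1, k(L+1)+1+L].
KILL CRITERIA. (K1) the laminar-puff theorem — every LH family from D_{5/6,W0} has nu_j∫|grad u_j|^2
-> 0 on O(1) windows (¬DecayQuantumWeak, and its [0,2]-window form) — refutes C2 =
RobustDecayQuantumR through Hopf's global solutions from the debris datum sampled at good times t_j
-> 0+ (strong L2-attainment of the datum puts u_j(t_j) within tolerance; energy inequality from a.e.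
t_j) => close refuted. (K2) An a-priori bound |grad u(t)|_inf <= C(f,E) nu^(-k) for bounded-energy
smooth-forced LH/NS families kills C1 for alpha > (k-1)/(k+1) => restate with smaller alpha or
close. (K3) A theorem that generic Euler collapse is atomic (alpha = 3/2 forced) or that arrested
debris is always within o(lambda^((3-2a)/2)) of a STEADY homogeneous Euler state (Shvydkoy2017
leaves only non-axisymmetric 3-D profiles possible for 0<alpha<2) => debris picture moot, close.
(K4) sparks-type necessity theorem showing debris visits + calm backgrounds are incompatible with
bounded energy.
RELATION TO ROUTE Sparks (route-AnomalousDissipation-Sparks, opened in parallel today; items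
SteadyForcedEulerBreakdown 1184, SingularitiesDissipate 1185, WindowStability 1186). Same event
architecture, different hinge: Sparks' SingularitiesDissipate quantifies the burn from SMOOTH
pre-blow-up data over a window containing the singularity (+ delay tau) and cites this card for the
delay; DebrisQuanta factors that hinge through the singular instant — InstantBurnNeedsConcentration
says nothing is burnt up to and at a non-atomic T*, so for alpha<1 collapses
SingularitiesDissipate(U0,T,tau≥1) follows from [collapse of U0 yields arrested debris D_{alpha,W}
at T*≤T] ∧ RobustDecayQuantumR — and files the dissipation half as statements about Navier–Stokes
from FIXED ROUGH DATA (C2, C3) that can be proved or refuted with no blow-up theory at all. No decl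
is shared verbatim (different quantifier shapes); if Sparks' planner prefers, C2 can be attached to
Sparks as the alpha<1 case of its hinge (wanted_by).
NOT DECOMPOSED YET (tenure, after a crux moves). Split of C2 into InnerReduction (blow-up of LH
solutions at scale lambda_j -> local-energy solution of unit-viscosity NS on R^3 from
curl(|y|^(1-alpha)W) + L2-perturbation; ChaeWolf/Kikuchi–Seregin local Leray theory is in tree) +
PuffLaw (the large-time rate above) + lower semicontinuity of the burn; the alpha >= 1 side
(NS-critical/supercritical debris, JiaSverak2014 non-uniqueness branch); the negative companion
"laminar forward-self-similar branch attracts" as a Neg-side item; definition collapseDebris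
requested to shorten signatures.
CHEAPEST FALSIFIER. The axisymmetric NO-SWIRL admissible profile W(y) = e_2 × y (alpha = 5/6, f = 0,
M = c = 0): if its cusp relaxes along the laminar quasi-self-similar branch (inner rate
s^{(1-2alpha)/(1+alpha)}, i.e. burn ~ nu), the ∀W form RobustDecayQuantumR is refuted on paper while
DecayQuantumWeak (non-axisymmetric W0) survives — refuters run this first; next cheapest, kit
numerics of the parameter-free inner problem (unit-viscosity NS on a large periodic box from the
truncated U_{5/6,W0}): does s^{(3alpha-2)/(1+alpha)}‖grad w(s)‖_2^2 stay bounded below (turbulent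
puff) or decay (laminar puff = K1)?
SEARCH LOG (the route's Novelty and Barriers fields hold the detail): card audited new-combination
twice, 2026-08-15; opening planner: crossref x6, lit read arXiv:1310.8611 pp.1-4 and
arXiv:1510.03378 pp.1-3; searchd/OpenAlex/arXiv/S2 unavailable or 429 that session, logged. REPAIR
LOG: 2026-08-15T16Z route-repair (refuted-misstated): + RobustDecayQuantumR (stmt-10549), Assembly
restated (stmt-10548), closes rewired, want of RobustDecayQuantum (stmt-2859) dropped — the decl's
negation stays in the negatives index.

Novelty: Searched 2026-08-15 (this planner): `lit search --source crossref` x6 ("locally self-similar blow-up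
Euler energy concentration"; "Navier-Stokes vanishing viscosity anomalous dissipation initial data
point singularity"; "Navier-Stokes slowly decaying initial data large time behavior homogeneous
weighted"; "homogeneous solutions 3D Euler system Shvydkoy"; "Leray Sedov-Taylor self-similar
singularity Euler Pomeau Le Berre"; "energy conservation point singularity Euler Onsager Shvydkoy")
— local searchd down (connection reset), OpenAlex/arXiv/S2 HTTP 429 all session (logged in
NOTES.md); `lit frontier AnomalousDissipation --since 2020` (adjacent Euler-side only:
arXiv:2412.08493 codimension-1 singular structures, arXiv:2510.10704 measure first derivatives);
`lit bridges AnomalousDissipation --cross any`; READ arXiv:1310.8611 pp.1-4 (BronziShvydkoy2015 Thm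
1.1: locally self-similar blow-up with mild L^p shell growth carries energy ∫_{|y|<L}|v|^2 ~
L^{N-2α}, 0<α<N/2; Rem 1.2 energy-measure dimension N-2α; Rem 1.5 atom/drain only at α=N/2) and
arXiv:1510.03378 pp.1-3 (Shvydkoy2017 = doi:10.1090/tran/7022: stationary homogeneous Euler states
|x|^{-α}V: none axisymmetric for 0<α<2, only irrotational ones with α∈Z\{1} found smooth with α>0,
anomalous flux vanishes at the Onsager-critical homogeneity); the card's two refuter novelty audits
(2026-08-15T09:xx and 10:28Z: crossref "Jeong Yoneda vortex stretching enhanced dissipation",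
"anomalous dissipation initial data"; priors added: do  [refs: 10.1090/tran/7022:, 10.1016/j.jmaa.2008.09.007, 10.1016/j.crme.2019.03.002, 2412.08493, 2510.10704, 1310.8611, 1510.03378, 0803.2056, 1806.04893, 2207.06301, doi:10.1090/tran/7022, doi:10.1016/j.jmaa.2008.09.007, doi:10.1016/j.crme.2019.03.002, BronziShvydkoy2015, Shvydkoy2017, BrueDeLellis2023, Cheskidov2023, BrenierDeLellisSzekelyhidi2011, BardosTitiWiedemann2012, JiaSverak2014]

Barriers (technique_class: euler-blow-up-events fixed-rough-datum unforced-decay): technique_class: euler-blow-up-events fixed-rough-datum unforced-decay (also: energy-measure,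
leray-hopf-inviscid-limit, finite-time, vanishing-viscosity)
- Literature.Barriers.AnomalousDissipation.BrenierDeLellisSzekelyhidi2011_cor1 [finite-time
fixed-data leray-hopf-inviscid-limit unforced-decay]: APPLIES to the class of C2/C3 (finite window,
fixed L^2 datum, Leray–Hopf, zero or steady force) and is EVADED by hypothesis failure: it needs an
Euler solution from the datum with ∫_0^T |∇v+∇v^T|_∞ < ∞; the debris datum D_{α,W} =
curl(χ|y|^{1-α}W(ŷ)) ~ |y|^{-α}, 2/3<α<1, is unbounded at one point (not even C^0), so no such
solution exists on any [0,T] — the route sits in the barrier's own evasions_known (2) "a FIXED but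
rough datum for which (8) fails from t=0". Item DebrisDatumRegular records the datum's class.
- Literature.Barriers.AnomalousDissipation.BrueDeLellis2023_noAnomaly_beforeEulerSingularity and
BrueDeLellis2023_noAnomaly_beforeEulerSingularityNarrow: USED, not fought. For the summit leg they
are the reason C1 is flagged blow-up-class (a finite-window burn from smooth recurrent states needs
forced-Euler breakdown; C1 asks for arrested α-collapse debris, i.e. beyond the classical lifespan).
For C2 the tolerance is chosen so the barrier cannot instance: a smooth datum within
c·λ_j^{(3-2α)/2} of D_{α,W} must resolve the cusp down to scale ≲ λ_j = ν_j^{1/(1-α)}, so its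
classical Euler lifespan is ≲ λ_j^{1+α} -> 0 and no ν-uniform classical Euler solution exists on the
uni

History (route lifecycle, newest last):
- 2026-08-15T12:17:17Z · BROKEN — RobustDecayQuantum (stmt-AnomalousDissipation-2859, crux) refuted by Summit.AnomalousDissipation.AnomalousDissipation.Theorems.DebrisQuantaRobustDecayQuantum_refuted (refuter-rreview-route-AnomalousDissipati-a258b335-0)
- 2026-08-15T16:18:19Z · rev 3: restated Assembly (stmt-AnomalousDissipation-2863) — repair: RobustDecayQuantum (stmt-2859) refuted-misstated by Theorems.DebrisQuantaRobustDecayQuantum_refuted (junk t=0 slice: Torus.IsLerayHopfOn never pins u 0) (planner-rrefute-AnomalousDissipation-DebrisQua-b6887ca1-g4-0)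
- 2026-08-15T16:21:43Z · rev 4: dropped RobustDecayQuantum — repair (2/2): drop this route's want of RobustDecayQuantum (stmt-2859, refuted-misstated by Theorems.DebrisQuantaRobustDecayQuantum_refuted — junk t=0 slice); i (planner-rrefute-AnomalousDissipation-DebrisQua-b6887ca1-g4-0)
- 2026-08-15T16:21:43Z · REPAIRED (drop RobustDecayQuantum) — back to open: repair (2/2): drop this route's want of RobustDecayQuantum (stmt-2859, refuted-misstated by Theorems.DebrisQuantaRobustDecayQuantum_refuted — junk t=0 slice); i (planner-rrefute-AnomalousDissipation-DebrisQua-b6887ca1-g4-0)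
- 2026-08-24T11:33:49Z · DORMANT — reconciler: no traction for 6.7 d (last activity item-evidence-added at 2026-08-17T17:06:52Z); parked, not closed — `ledger route dormant route-AnomalousDissipa (operator:999:2681495)

sub-problem: AnomalousDissipation · status: dormant · opened planner-plancard-AnomalousDissipation-Anomalo-0381bd75-0 2026-08-15T11:09:03Z · rev 4 · ledger route-AnomalousDissipation-DebrisQuanta
GENERATED by the gate from the ledger (D-0016/17). Provers cite these decls: `theorem foo : Summit.AnomalousDissipation.AnomalousDissipation.Theses.DebrisQuanta.<Decl> := …` in Summits/AnomalousDissipation/AnomalousDissipation/Theorems/<Name>.lean.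
-/

namespace Summit.AnomalousDissipation.AnomalousDissipation.Theses.DebrisQuanta

open scoped BigOperators Topology Manifold Classical MeasureTheory ProbabilityTheory Matrix InnerProductSpace ComplexConjugate ContinuousMap
open Filter Set Function TopologicalSpace MeasureTheory

attribute [summit_statement] _root_.AnomalousDissipation

open Literature.Turb

/-- item stmt-AnomalousDissipation-2858 · crux · rank 2 · open · by planner
why it might fail: Needs ν-uniform RECURRENT collapse to a |y|^-α cusp (2/3<α<1) in bounded-energy smooth-forced flow on T³: beyond all known blow-ups (Elgindi2021: C^{1,a} data; ChenHou2023: boundary; arXiv:2309.08495: rough force, one event); locally self-similar collapse mostly excluded (Chae2007, arXiv:1310.8611).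
sources: BronziShvydkoy2015, Chae2007, Elgindi2021, ChenHou2023, arXiv:2309.08495, BrueDeLellis2023
[crux] RECURRENT DEBRIS (sparks' Hyp1 restricted to alpha-collapse with 2/3<alpha<1, plus Return,
restated over debris states; the UNPROVED blow-up-class leg, deliberately the FIRST crux): ∃ smooth
steady div-free mean-zero f, 2/3<alpha<1, admissible profile potential W, constants M c L E, nu_j→0
and global Leray–Hopf u_j (force f) with sup_{t≥0} kineticEnergy(u_j t) ≤ E such that every window
[T,T+L] contains a time t FROM WHICH THE ENERGY INEQUALITY HOLDS with u_j(t) = b + D_{alpha,W}(·−a)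
+ w: b smooth div-free with |lift b|, ‖D(lift b)‖ ≤ M (calm large scales), a ∈ T³ the collapse
point, ‖w‖_{L²} ≤ c·nu_j^{(3−2alpha)/(2(1−alpha))} = c·lambda_j^{(3−2alpha)/2} — exactly the energy
D carries below the viscous ARREST SCALE lambda_j = nu_j^{1/(1−alpha)} (local Reynolds number
rho^{1−alpha}/nu = 1 at rho = lambda; for alpha<1 viscosity halts the collapse there, card E2).
D_{alpha,W}(x) := curl_z[ chi(|z|) |z|^{1-alpha} W(z/|z|) ] at z = repr x − (1/2,1/2,1/2), chi(r) =
smoothTransition(2−8r) (=1 for r≤1/8, =0 for r≥1/4): a compactly supported, automatically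
divergence-free field, equal to the degree-(−alpha) homogeneous field U_{alpha,W} =
curl(|z|^{1-alpha}W(ẑ)) near the centre, |D| -/
@[route_item "route-AnomalousDissipation-DebrisQuanta", crux]
def RecurrentDebris : Prop :=
  let D : ℝ → (EuclideanSpace ℝ (Fin 3) → EuclideanSpace ℝ (Fin 3)) → UnitAddTorus (Fin 3) → EuclideanSpace ℝ (Fin 3) := fun α W x => Literature.Analysis.FluidPDE.curl (fun z : EuclideanSpace ℝ (Fin 3) => (Real.smoothTransition (2 - 8 * ‖z‖) * ‖z‖ ^ (1 - α)) • W (‖z‖⁻¹ • z)) (Literature.Analysis.FunctionSpaces.Torus.repr x - (!₂[(1:ℝ)/2, 1/2, 1/2] : EuclideanSpace ℝ (Fin 3))); let Adm : ℝ → (EuclideanSpace ℝ (Fin 3) → EuclideanSpace ℝ (Fin 3)) → Prop := fun α W => ContDiff ℝ ((⊤ : ℕ∞) : WithTop ℕ∞) W ∧ ∃ y : EuclideanSpace ℝ (Fin 3), y ≠ 0 ∧ Literature.Analysis.FluidPDE.curl (fun z : EuclideanSpace ℝ (Fin 3) => (‖z‖ ^ (1 - α)) • W (‖z‖⁻¹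 • z)) y ≠ 0; let Bg : ℝ → (UnitAddTorus (Fin 3) → EuclideanSpace ℝ (Fin 3)) → Prop := fun M b => Literature.Analysis.FunctionSpaces.Torus.IsSmooth b ∧ Literature.Analysis.FunctionSpaces.Torus.IsDivFree b ∧ ∀ y : EuclideanSpace ℝ (Fin 3), ‖Literature.Analysis.FunctionSpaces.Torus.lift b y‖ ≤ M ∧ ‖fderiv ℝ (Literature.Analysis.FunctionSpaces.Torus.lift b) y‖ ≤ M; let Good : ℝ → (UnitAddTorus (Fin 3) → EuclideanSpace ℝ (Fin 3)) → (ℝ → UnitAddTorus (Fin 3) → EuclideanSpace ℝ (Fin 3)) → ℝ → Prop := fun ν f u t₀ => ∀ t : ℝ, t₀ ≤ t → Literature.Analysis.FunctionSpaces.Torus.kineticEnergy (u t) + ν * (∫⁻ s in Set.Ioo t₀ t, Literature.Analysis.FunctionSpaces.Torus.eGradNormSq (u s)).toReal ≤ Literature.Analysis.FunctionSpaces.Torus.kineticEnergy (u t₀) + ∫ s in t₀..t, ∫ x, inner ℝ (f x) (u s x); ∃ (α : ℝ) (W : EuclideanSpace ℝ (Fin 3) → EuclideanSpace ℝ (Fin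 3)) (f : UnitAddTorus (Fin 3) → EuclideanSpace ℝ (Fin 3)) (M c L E : ℝ) (ν : ℕ → ℝ) (u₀ : ℕ → UnitAddTorus (Fin 3) → EuclideanSpace ℝ (Fin 3)) (u : ℕ → ℝ → UnitAddTorus (Fin 3) → EuclideanSpace ℝ (Fin 3)), 2/3 < α ∧ α < 1 ∧ Adm α W ∧ Literature.Analysis.FunctionSpaces.Torus.IsSmooth f ∧ Literature.Analysis.FunctionSpaces.Torus.IsDivFree f ∧ Literature.Analysis.FunctionSpaces.Torus.HasZeroMean f ∧ 0 < L ∧ (∀ j, 0 < ν j) ∧ Filter.Tendsto ν Filter.atTop (nhds 0) ∧ (∀ j, Literature.Analysis.FluidPDE.Torus.IsGlobalLerayHopf (ν j) (fun _ => f) (u₀ j) (u j)) ∧ (∀ j (t : ℝ), 0 ≤ t → Literature.Analysis.FunctionSpaces.Torus.kineticEnergy (u j t) ≤ E) ∧ ∀ j (T : ℝ), 0 ≤ T → ∃ t ∈ Set.Icc T (T + L), ∃ (a : UnitAddTorus (Fin 3)) (b : UnitAddTorus (Fin 3) → EuclideanSpace ℝ (Fin 3)), Good (ν j) f (u j) t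 ∧ Bg M b ∧ MeasureTheory.eLpNorm (fun x => u j t x - b x - D α W (x - a)) 2 MeasureTheory.volume ≤ ENNReal.ofReal (c * (ν j) ^ ((3 - 2 * α) / (2 * (1 - α))))

/-- item stmt-AnomalousDissipation-10549 · crux · rank 3 · open · by planner
why it might fail: t=0 junk closed (0<t_j: slices at t>0 are pinned by weak continuity). Real risk: ∀W admits axisymmetric no-swirl cusps (W=e₂×y) and near-steady homogeneous profiles (Shvydkoy2017) whose LH flows may stay laminar, burn~ν→0; self-similar α→1 end (JiaSverak2014); no fixed-datum anomaly is known.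
sources: Hopf1951, Galdi2000, JiaSverak2014, Shvydkoy2017, arXiv:1906.07400, BronziShvydkoy2015
[crux] ROBUST DECAY QUANTUM, REPAIRED (supersedes RobustDecayQuantum =
stmt-AnomalousDissipation-2859, refuted AS TYPED by Theorems.DebrisQuantaRobustDecayQuantum_refuted
through the junk t=0 slice: Torus.IsLerayHopfOn never pins u 0 — only u 0 ∈ L² and KE(u 0) ≤ KE(u₀)
— so with t_j = 0 a constant drift carrying the debris profile only at the unpinned slice met every
hypothesis and burnt 0). CHANGES: (i) debris times are STRICTLY POSITIVE, 0 < t_j (was 0 ≤ t_j):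
every slice u_j(t), t > 0, of a Leray–Hopf solution is pinned a.e. by weak L²-continuity on (0,T]
(Hopf1951; Galdi2000 Lemma 2.2), so the debris condition constrains the actual flow; data still
enter only through u₀, and RecurrentDebris supplies visits in every window [T,T+L] with T > 0, which
is all AssemblyR uses; (ii) the steady force is also asked divergence-free and mean-zero
(RecurrentDebris provides both) — a pure weakening. CLAIM: ∀ 2/3<alpha<1, admissible W, smooth
div-free mean-zero steady f, M, c ∃ q>0: for every sequence nu_j→0 of global Leray–Hopf solutions
forced by f and all times t_j > 0 from which the energy inequality holds and at which u_j(t_j) = b_j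
+ D_{alpha,W}(·−a_j) + w_j (b_j smooth div-free, |b_j| -/
@[route_item "route-AnomalousDissipation-DebrisQuanta", crux]
def RobustDecayQuantumR : Prop :=
  let D : ℝ → (EuclideanSpace ℝ (Fin 3) → EuclideanSpace ℝ (Fin 3)) → UnitAddTorus (Fin 3) → EuclideanSpace ℝ (Fin 3) := fun α W x => Literature.Analysis.FluidPDE.curl (fun z : EuclideanSpace ℝ (Fin 3) => (Real.smoothTransition (2 - 8 * ‖z‖) * ‖z‖ ^ (1 - α)) • W (‖z‖⁻¹ • z)) (Literature.Analysis.FunctionSpaces.Torus.repr x - (!₂[(1:ℝ)/2, 1/2, 1/2] : EuclideanSpace ℝ (Fin 3))); let Adm : ℝ → (EuclideanSpace ℝ (Fin 3) → EuclideanSpace ℝ (Fin 3)) → Prop := fun α W => ContDiff ℝ ((⊤ : ℕ∞) : WithTop ℕ∞) W ∧ ∃ y : EuclideanSpace ℝ (Fin 3), y ≠ 0 ∧ Literature.Analysis.FluidPDE.curl (fun z : EuclideanSpace ℝ (Fin 3) => (‖z‖ ^ (1 - α)) • W (‖z‖⁻¹ • z)) y ≠ 0; let Bg : ℝ → (UnitAddTorus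 (Fin 3) → EuclideanSpace ℝ (Fin 3)) → Prop := fun M b => Literature.Analysis.FunctionSpaces.Torus.IsSmooth b ∧ Literature.Analysis.FunctionSpaces.Torus.IsDivFree b ∧ ∀ y : EuclideanSpace ℝ (Fin 3), ‖Literature.Analysis.FunctionSpaces.Torus.lift b y‖ ≤ M ∧ ‖fderiv ℝ (Literature.Analysis.FunctionSpaces.Torus.lift b) y‖ ≤ M; let Good : ℝ → (UnitAddTorus (Fin 3) → EuclideanSpace ℝ (Fin 3)) → (ℝ → UnitAddTorus (Fin 3) → EuclideanSpace ℝ (Fin 3)) → ℝ → Prop := fun ν f u t₀ => ∀ t : ℝ, t₀ ≤ t → Literature.Analysis.FunctionSpaces.Torus.kineticEnergy (u t) + ν * (∫⁻ s in Set.Ioo t₀ t, Literature.Analysis.FunctionSpaces.Torus.eGradNormSq (u s)).toReal ≤ Literature.Analysis.FunctionSpaces.Torus.kineticEnergy (u t₀) + ∫ s in t₀..t, ∫ x, inner ℝ (f x) (u s x); let burn : ℝ → (ℝ → UnitAddTorus (Fin 3) → EuclideanSpace ℝ (Fin 3)) → ℝ → ℝ → ℝ := fun ν u a b => ν * (∫⁻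 s in Set.Ioo a b, Literature.Analysis.FunctionSpaces.Torus.eGradNormSq (u s)).toReal; ∀ (α : ℝ) (W : EuclideanSpace ℝ (Fin 3) → EuclideanSpace ℝ (Fin 3)) (f : UnitAddTorus (Fin 3) → EuclideanSpace ℝ (Fin 3)) (M c : ℝ), 2/3 < α → α < 1 → Adm α W → Literature.Analysis.FunctionSpaces.Torus.IsSmooth f → Literature.Analysis.FunctionSpaces.Torus.IsDivFree f → Literature.Analysis.FunctionSpaces.Torus.HasZeroMean f → ∃ q : ℝ, 0 < q ∧ ∀ (ν t : ℕ → ℝ) (a : ℕ → UnitAddTorus (Fin 3)) (b : ℕ → UnitAddTorus (Fin 3) → EuclideanSpace ℝ (Fin 3)) (u₀ : ℕ → UnitAddTorus (Fin 3) → EuclideanSpace ℝ (Fin 3)) (u : ℕ → ℝ → UnitAddTorus (Fin 3) → EuclideanSpace ℝ (Fin 3)), (∀ j, 0 < ν j) → Filter.Tendsto ν Filter.atTop (nhds 0) → (∀ j, Literature.Analysis.FluidPDE.Torus.IsGlobalLerayHopf (ν j) (fun _ => f) (u₀ j) (u j)) → (∀ j, 0 < t j ∧ Good (ν j) f (u j)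 (t j)) → (∀ j, Bg M (b j)) → (∀ j, MeasureTheory.eLpNorm (fun x => u j (t j) x - b j x - D α W (x - a j)) 2 MeasureTheory.volume ≤ ENNReal.ofReal (c * (ν j) ^ ((3 - 2 * α) / (2 * (1 - α))))) → ∀ᶠ j in Filter.atTop, q ≤ burn (ν j) (u j) (t j) (t j + 1)

/-- item stmt-AnomalousDissipation-2860 · crux · rank 4 · open · by planner
why it might fail: Would be the FIRST non-vanishing burn for unforced NS from ONE fixed L² datum (arXiv:1902.02032 Thm 3: only ν^{a0}·enstrophy>1, a0<1, L²-convergent data, a0=1 open; arXiv:2307.06812: ν-dependent data). α=5/6 tip is NS-subcritical, smooths at once; the O(1) eddy may stay laminar: burn~ν^θ.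
sources: arXiv:1902.02032, arXiv:2307.06812, arXiv:2207.06301, BrenierDeLellisSzekelyhidi2011, BardosTitiWiedemann2012, JiaSverak2014
[crux] DECAY QUANTUM, WEAK FORM — the bare milestone on ONE explicit datum: W0(y) = (0, y_0, 1),
alpha = 5/6, so near the centre D = curl(|z|^{1/6}(0, z_0/|z|, 1)) = ((1/6)|z|^{-11/6}z_1 +
(5/6)|z|^{-17/6}z_0z_2, −(1/6)|z|^{-11/6}z_0, |z|^{-5/6} − (5/6)|z|^{-17/6}z_0²): a genuinely 3-D,
NON-axisymmetric singular vortex (a swirl about e_2 superposed with a differential rotation about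
e_1), |D| ~ |z|^{-5/6}, D ∈ L² \ C⁰, Onsager class B^{1/6}_{3,∞}; ZERO force; claim: there EXIST
nu_j→0 and Leray–Hopf solutions u_j on [0,1] from this SAME datum with ∃q>0, eventually
nu_j∫_0^1‖∇u_j‖² ≥ q. LH families exist (hopf_existence_torus_holds + DebrisDatumRegular); implied
by RobustDecayQuantum (b=0, f=0, t=0, w=0). Point-debris twin of kh-fixed-ripple's FixedDatumAnomaly
(sheet + ripple). Its NEGATION ('laminar puff': every LH family from this datum has vanishing burn
on [0,1]) refutes RobustDecayQuantum and closes the route — the cheapest decisive test; 5/6 and W0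
are fixed for definiteness (any alpha in (2/3,1), any admissible non-steady profile would do). -/
@[route_item "route-AnomalousDissipation-DebrisQuanta", crux]
def DecayQuantumWeak : Prop :=
  let D : ℝ → (EuclideanSpace ℝ (Fin 3) → EuclideanSpace ℝ (Fin 3)) → UnitAddTorus (Fin 3) → EuclideanSpace ℝ (Fin 3) := fun α W x => Literature.Analysis.FluidPDE.curl (fun z : EuclideanSpace ℝ (Fin 3) => (Real.smoothTransition (2 - 8 * ‖z‖) * ‖z‖ ^ (1 - α)) • W (‖z‖⁻¹ • z)) (Literature.Analysis.FunctionSpaces.Torus.repr x - (!₂[(1:ℝ)/2, 1/2, 1/2] : EuclideanSpace ℝ (Fin 3))); let burn : ℝ → (ℝ → UnitAddTorus (Fin 3) → EuclideanSpace ℝ (Fin 3)) → ℝ → ℝ → ℝ := fun ν u a b => ν * (∫⁻ s in Set.Ioo a b, Literature.Analysis.FunctionSpaces.Torus.eGradNormSq (u s)).toReal; ∃ (ν : ℕ → ℝ) (u : ℕ → ℝ → UnitAddTorus (Fin 3) → EuclideanSpace ℝ (Fin 3)), (∀ j, 0 < ν j) ∧ Filter.Tendsto ν Filter.atTop (nhds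 0) ∧ (∀ j, Literature.Analysis.FluidPDE.Torus.IsLerayHopfOn 1 (ν j) 0 (D (5/6) (fun y : EuclideanSpace ℝ (Fin 3) => (!₂[0, y 0, 1] : EuclideanSpace ℝ (Fin 3)))) (u j)) ∧ ∃ q : ℝ, 0 < q ∧ ∀ᶠ j in Filter.atTop, q ≤ burn (ν j) (u j) 0 1

/-- item stmt-AnomalousDissipation-2861 · support · rank 9 · open · by planner
sources: Hopf1951, BronziShvydkoy2015, Cheskidov2023
[support] NO INSTANT BURN WITHOUT CONCENTRATION (card Q1/E1 made rigorous and ansatz-free; provable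
now): Leray–Hopf solutions u_j on [0,1] (viscosities 0<nu_j≤1, steady smooth forces g_j with ‖g_j‖_∞
≤ F) whose data u0_j CONVERGE in L² to some v ∈ L² burn ≤ eps on [0,tau(eps)], eventually in j.
Proof: energy inequality from 0 gives burn(0,tau) ≤ KE(u0_j) − KE(u_j(tau)) + tau·F·(2 sup
KE)^{1/2}; low modes of an LH solution are Lipschitz in time: each Fourier coefficient is absolutely
continuous with |d/dt û(k)| ≤ 2π|k|·‖u‖²_{L²} + 4π²nu|k|²|û(k)| + |ĝ(k)| (weak form tested with one
character × time cutoff), so ‖P_{≤K}(u_j(tau) − u0_j)‖ ≤ delta_K(tau) := N(K)^{1/2}·tau·C(K,E,F) and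
KE(u_j(tau)) ≥ ½‖P_{≤K}u0_j‖² − delta‖u0_j‖; hence burn ≤ ½‖P_{>K}u0_j‖² + delta_K(tau)‖u0_j‖ +
tau·F(2E)^{1/2} with ‖P_{>K}u0_j‖ ≤ ‖P_{>K}v‖ + ‖u0_j − v‖ → choose K, then tau, then j.
Contrapositive = the card's table: a quantum burnt on arbitrarily short windows FORCES loss of
L²-precompactness of the states (energy concentration — the alpha = 3/2 atom of BronziShvydkoy2015
Rem 1.5); the quantum of every non-atomic event is a DECAY quantum of the limit datum over a window
of positive length. -/
@[route_item "route-AnomalousDissipation-DebrisQuanta", crux]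
def InstantBurnNeedsConcentration : Prop :=
  let burn : ℝ → (ℝ → UnitAddTorus (Fin 3) → EuclideanSpace ℝ (Fin 3)) → ℝ → ℝ → ℝ := fun ν u a b => ν * (∫⁻ s in Set.Ioo a b, Literature.Analysis.FunctionSpaces.Torus.eGradNormSq (u s)).toReal; ∀ (F : ℝ) (ν : ℕ → ℝ) (g : ℕ → UnitAddTorus (Fin 3) → EuclideanSpace ℝ (Fin 3)) (u₀ : ℕ → UnitAddTorus (Fin 3) → EuclideanSpace ℝ (Fin 3)) (v : UnitAddTorus (Fin 3) → EuclideanSpace ℝ (Fin 3)) (u : ℕ → ℝ → UnitAddTorus (Fin 3) → EuclideanSpace ℝ (Fin 3)), (∀ j, 0 < ν j ∧ ν j ≤ 1) → (∀ j, Literature.Analysis.FunctionSpaces.Torus.IsSmooth (g j)) → (∀ j x, ‖g j x‖ ≤ F) → (∀ j, Literature.Analysis.FluidPDE.Torus.IsLerayHopfOn 1 (ν j) (fun _ => g j) (u₀ j) (u j)) → MeasureTheory.MemLp v 2 MeasureTheory.volume → Filter.Tendsto (fun j => MeasureTheory.eLpNorm (u₀ j - v) 2 MeasureTheory.volume) Filter.atTop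 (nhds 0) → ∀ ε : ℝ, 0 < ε → ∃ τ : ℝ, 0 < τ ∧ τ ≤ 1 ∧ ∀ᶠ j in Filter.atTop, burn (ν j) (u j) 0 τ ≤ ε

/-- item stmt-AnomalousDissipation-2862 · support · rank 9 · open · by planner
sources: Shvydkoy2017, Hopf1951
[support] DEBRIS DATUM CLASS (provable now): (i) for 0<alpha<3/2 and admissible W, D_{alpha,W} ∈
L²(T³) and is weakly divergence-free; (ii) W0(y) = (0, y_0, 1) is admissible for every alpha<1.
D_{alpha,W}(x) := curl_z[ chi(|z|) |z|^{1-alpha} W(z/|z|) ] at z = repr x − (1/2,1/2,1/2), chi(r) =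
smoothTransition(2−8r) (=1 for r≤1/8, =0 for r≥1/4): a compactly supported, automatically
divergence-free field, equal to the degree-(−alpha) homogeneous field U_{alpha,W} =
curl(|z|^{1-alpha}W(ẑ)) near the centre, |D| ~ |z|^{-alpha}, smooth off one point, Onsager class
B^{1-alpha}_{3,∞} (supercritical iff alpha>2/3), shell energy ∫_{B_rho}|D|² ~ rho^{3−2alpha}
(Bronzi–Shvydkoy dimension). Adm(alpha,W) := W ∈ C^∞(E³;E³) and U_{alpha,W} ≠ 0 somewhere off 0.
Proof notes: the potential Phi(z) = chi(|z|)|z|^{1−alpha}W(z/|z|) is smooth off 0 with |∇Phi| ≲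
|z|^{-alpha} ∈ L² for alpha<3/2, so D = curl Phi (classical off the centre;
Literature.Analysis.FluidPDE.curl has junk 0 at the single non-differentiability point) is in L²,
continuous off one point (a.e.-strongly measurable via the measure-preserving repr/proj of
FlatTorus), and ∫⟪curl Phi, ∇θ⟫ = 0 for smooth θ on T³ (integrate by parts on the pun -/
@[route_item "route-AnomalousDissipation-DebrisQuanta", crux]
def DebrisDatumRegular : Prop :=
  let D : ℝ → (EuclideanSpace ℝ (Fin 3) → EuclideanSpace ℝ (Fin 3)) → UnitAddTorus (Fin 3) → EuclideanSpace ℝ (Fin 3) := fun α W x => Literature.Analysis.FluidPDE.curl (fun z : EuclideanSpace ℝ (Fin 3) => (Real.smoothTransition (2 - 8 * ‖z‖) * ‖z‖ ^ (1 - α)) • W (‖z‖⁻¹ • z)) (Literature.Analysis.FunctionSpaces.Torus.repr x - (!₂[(1:ℝ)/2, 1/2, 1/2] : EuclideanSpace ℝ (Fin 3))); let Adm : ℝ → (EuclideanSpace ℝ (Fin 3) → EuclideanSpace ℝ (Fin 3)) → Prop := fun α W => ContDiff ℝ ((⊤ : ℕ∞) : WithTop ℕ∞) W ∧ ∃ y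 : EuclideanSpace ℝ (Fin 3), y ≠ 0 ∧ Literature.Analysis.FluidPDE.curl (fun z : EuclideanSpace ℝ (Fin 3) => (‖z‖ ^ (1 - α)) • W (‖z‖⁻¹ • z)) y ≠ 0; (∀ (α : ℝ) (W : EuclideanSpace ℝ (Fin 3) → EuclideanSpace ℝ (Fin 3)), 0 < α → α < 3/2 → Adm α W → MeasureTheory.MemLp (D α W) 2 MeasureTheory.volume ∧ Literature.Analysis.FunctionSpaces.Torus.IsWeaklyDivFree (D α W)) ∧ ∀ α : ℝ, α < 1 → Adm α (fun y : EuclideanSpace ℝ (Fin 3) => (!₂[0, y 0, 1] : EuclideanSpace ℝ (Fin 3)))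

-- earlier Assembly (stmt-AnomalousDissipation-2863, replaced 2026-08-15T16:18:19Z -> stmt-AnomalousDissipation-10548): retired by None — RobustDecayQuantum → RecurrentDebris → AnomalousDissipation
/-- item stmt-AnomalousDissipation-10548 · assembly · rank 1 · open · by planner
sources: DoeringFoias2002, Hopf1951
[assembly] REPAIRED 2026-08-15: RobustDecayQuantumR → RecurrentDebris → AnomalousDissipation (=
Literature.Turb.ZerothLaw); restates stmt-AnomalousDissipation-2863 (RobustDecayQuantum →
RecurrentDebris → AnomalousDissipation), vacuous once its antecedent RobustDecayQuantum was refuted.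
From RecurrentDebris take alpha W f M c L E nu u0 u (f smooth, div-free, mean-zero).
RobustDecayQuantumR(alpha,W,f,M,c) gives q>0. Use only windows with POSITIVE left end, T_k :=
k(L+1)+1 (k ∈ ℕ): the visit t_k ∈ [T_k, T_k+L] has t_k ≥ 1 > 0 as the repaired crux requires. CLAIM
∃J ∀j≥J ∀k: the visit (t,a,b) of u_j in [T_k,T_k+L] burns nu_j∫_t^{t+1}‖∇u_j‖² ≥ q — otherwise pick
bad visits (j_i,t_i) with j_i strictly increasing and apply RobustDecayQuantumR to the reindexed
family (nu∘j_i > 0, → 0; global LH; 0 < t_i with Good; Bg M; debris tolerance) to contradict '∀ᶠ'.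
For j ≥ J the burn windows [t_k, t_k+1] ⊂ [k(L+1)+1, (k+1)(L+1)+1] are pairwise disjoint (up to
endpoints), so ∫_0^{n(L+1)+1} nu_j‖∇u_j‖² ≥ nq (integrand ≥ 0; t ↦ nu·(eGradNormSq(u t)).toReal is
integrable on bounded intervals by IsLerayHopfOn.memL2Sobolev and its integral over [t_k,t_k+1] is
nu·(∫⁻ eGradNormSq).toReal by integral_toRea -/
@[route_item "route-AnomalousDissipation-DebrisQuanta", crux]
def Assembly : Prop :=
  RobustDecayQuantumR → RecurrentDebris → AnomalousDissipation

-- records of items no longer active in this route (dropped / restated):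
-- earlier RobustDecayQuantum (stmt-AnomalousDissipation-2859, dropped 2026-08-15T16:21:43Z): refuted by Summit.AnomalousDissipation.AnomalousDissipation.Theorems.DebrisQuantaRobustDecayQuantum_refuted — let D : ℝ → (EuclideanSpace ℝ (Fin 3) → EuclideanSpace ℝ (Fin 3)) → UnitAddTorus (Fin 3) → EuclideanSpace ℝ (Fin 3) := fun α W x => Literature.Analysis.FluidPDE.curl (fun z : EuclideanSpace ℝ (Fin 3)

/-! D-0027 §2.1 — DECIDING THEOREM (planner-authored via `route open/edit --closes-file`; by planner-rrefute-AnomalousDissipation-DebrisQua-b6887ca1-g4-0 2026-08-15T17:02:16Z):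
its hypotheses are this route's items and its conclusion the sub-problem Statement (glue_lint), and it elaborates with this file. -/

@[closes "route-AnomalousDissipation-DebrisQuanta"] theorem closes : RecurrentDebris → DecayQuantumWeak → InstantBurnNeedsConcentration → DebrisDatumRegular → RobustDecayQuantumR → Assembly → _root_.AnomalousDissipation := fun h_RecurrentDebris h_DecayQuantumWeak h_InstantBurnNeedsConcentration h_DebrisDatumRegular h_RobustDecayQuantumR h_Assembly => h_Assembly h_RobustDecayQuantumR h_RecurrentDebris

end Summit.AnomalousDissipation.AnomalousDissipation.Theses.DebrisQuanta
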